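import Literature.AlgebraicGeometry.Resolution.HenselizedFunctionFieldsProofs
import Literature.AlgebraicGeometry.Resolution.HenselizationDefectless
import HarnessLib

/-!
# No proper immediate algebraic extensions (Kuhlmann 2010, §5, p. 19) — proof from the ingredients

Topic: `Literature/AlgebraicGeometry/Resolution` (valued function fields). The displayed statement
of p. 19 of F.-V. Kuhlmann, *Elimination of ramification I: The generalized stability theorem*,
Trans. AMS 362 (2010) = arXiv:1003.5678,

> *Henselized inertially generated function fields of rank 1 and of transcendence degree 1 with
> a valuation-transcendental generator over an algebraically closed ground field do not admit
> proper immediate algebraic extensions.*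

in the residue-transcendental case (the class `IsHenselizedInertiallyGeneratedRT V K` of
`HenselizedFunctionFields.lean`), vendored as the named fact
`Kuhlmann2010NoImmediateExtensionRT` and PROVED from the ingredients of its printed proof
(pp. 18–19): the reduction to a tower of normal extensions of degree `p` over a finite unramified
`N` (`Kuhlmann2010TameTowerReduction`, with Lemma 2.27), Prop. 2.18
(`Kuhlmann2010DefectUnramifiedBaseChange`) and Cor. 4.2 / Prop. 3.1 for the first step of the
tower (`Kuhlmann2010NormalDegreePDefectless`):

> By Proposition 2.18 we have `d(E|F,v) = d(E.N|N,v)`, hence it suffices to prove that `E.N|N`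
> is defectless. Since this is trivial if `E.N = N`, we assume that `E.N ≠ N`. Then the first
> extension in the tower is defectless by Corollary 4.2 or Proposition 3.1. This yields
> `d(E|F,v) = d(E.N|N,v) < [E.N:N] ≤ [E:F]`, that is, `(E|F,v)` cannot be immediate.

It is the input of Lemma 5.5 (`Kuhlmann2010FiniteExtensionInertiallyGenerated`), whose printed
proof ends with "But as proved above, the henselized inertially generated function field … does
not admit any proper immediate algebraic extension. This yields `F = K(x')^h(y')`."

## Content (everything PROVED except the named fact, which is then discharged from the parts)

* `isAlgebraic_of_relfinrank_pos`, `IsHenselianField.of_subfield_algebraic` (Lemma 2.3, first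
  part, for subfields of `Ω`), `IsHenselizedInertiallyGeneratedRT.isHenselianField` — the fields
  of the class are henselian (`K(x)^h` is, `Kuhlmann2010HenselizationIsHenselian_holds`, and they
  are finite over it).
* `relIndex_mul_relfinrank_le_relfinrank` — the fundamental inequality `e·f ≤ n` for subfields
  `A ≤ B` of `(Ω, V)` (`(vB : vA)·[Bv : Av] ≤ [B : A]`, both factors positive), from
  `ramificationIndex_mul_inertiaDegree_le_finrank` through `DefectAmbient.lean`.
* `IsNormalPTower.relfinrank_pos` — a tower of steps of degree `p > 0` is finite.
* `residueSubfield_subfield_eq_resField`, `IsImmediateOver.valueSubgroup_eq_and_residueSubfield_eq`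
  — "immediate" (`IsImmediateOver`, every value and residue of `E` is one of `F`) as the
  equalities `vE = vF`, `Ev = Fv` of value subgroups and residue subfields.
* `eq_of_isHenselizedInertiallyGeneratedRT_of_immediate_finite` — the finite case of the
  displayed statement, PROVED from the three named facts.
* `Kuhlmann2010NoImmediateExtensionRT` — NAMED FACT (the displayed statement, residue-
  transcendental case, for algebraic extensions inside `Ω`, "immediate" = `IsImmediateOver` of
  `KnafKuhlmann2009Thm11Parts.lean`), and `Kuhlmann2010NoImmediateExtensionRT.of_parts` — its
  PROOF from `Kuhlmann2010TameTowerReduction`, `Kuhlmann2010DefectUnramifiedBaseChange`,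
  `Kuhlmann2010NormalDegreePDefectless` along the lines quoted above (finite case; an algebraic
  immediate extension is exhausted by its finite immediate subextensions `F(a)`).
* `Kuhlmann2010StabilityRankOneResidueTranscendental.of_namedFacts` — with Thm. 2.14 now PROVED
  (`HenselizationDefectless.lean`), (R4) for `K(t)`, `t` residue-transcendental, from the five
  named facts of `HenselizedFunctionFields.lean`.

## Sources

* F.-V. Kuhlmann, Trans. AMS 362 (2010) = arXiv:1003.5678: §1 ((1), "`g = 1` if `(K,v)` is
  henselian"), §2.1 (immediate extensions; Lemma 2.3), §2.3 (Lemma 2.13, Prop. 2.18), §5, proof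
  of (R4), pp. 18–19 (the displayed statement and the five lines before it).
-/

noncomputable section

open IsLocalRing

namespace Literature.AlgebraicGeometry.Resolution

universe u

variable {Ω : Type u} [Field Ω] (V : ValuationSubring Ω)

/-! ### Finite subextensions inside `Ω`: algebraicity, henselian fields -/

/-- Elements of `B` are algebraic over `A` when `A ≤ B` and `[B : A]` is finite. [folklore] -/
theorem isAlgebraic_of_relfinrank_pos {A B : Subfield Ω} (h : A ≤ B)
    (hpos : 0 < Subfield.relfinrank A B) {y : Ω} (hy : y ∈ B) : IsAlgebraic A y := by
  set B' : IntermediateField A Ω := Subfield.extendScalars h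
  haveI : FiniteDimensional A B' := by
    rw [Subfield.relfinrank_eq_finrank_of_le h] at hpos
    exact Module.finite_of_finrank_pos hpos
  have h1 : IsAlgebraic A (⟨y, hy⟩ : B') := Algebra.IsAlgebraic.isAlgebraic _
  exact h1.algebraMap

/-- **Kuhlmann 2010, Lemma 2.3 (first part) for subfields of `Ω`**: an algebraic extension
`F ≥ H` of a henselian `(H, V ∩ H)` is henselian for `V ∩ F` ("An algebraic extension of a
henselian valued field, equipped with the unique extension of the valuation, is again
henselian"). PROVED from the typed `IsHenselianField.of_isAlgebraic`-style argument: an algebraic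
extension of `F` is one of `H`, over which any two extensions of `V ∩ H` agree.
[cite: Kuhlmann2010, Lemma 2.3] -/
theorem IsHenselianField.of_subfield_algebraic {H F : Subfield Ω} (hHF : H ≤ F)
    (halg : ∀ y ∈ F, IsAlgebraic H y) (hH : IsHenselianField H (V.comap (algebraMap H Ω))) :
    IsHenselianField F (V.comap (algebraMap F Ω)) := by
  intro L _ _ hL O₁ O₂ h₁ h₂
  haveI := hL
  letI algHF : Algebra H F := (Subfield.inclusion hHF).toAlgebra
  haveI : IsScalarTower H F Ω := IsScalarTower.of_algebraMap_eq fun _ => rfl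
  letI algHL : Algebra H L := ((algebraMap F L).comp (algebraMap H F)).toAlgebra
  haveI : IsScalarTower H F L := IsScalarTower.of_algebraMap_eq fun _ => rfl
  haveI : Algebra.IsAlgebraic H F := by
    refine ⟨fun y => ?_⟩
    have hy : IsAlgebraic H (algebraMap F Ω y) := halg y y.2
    exact hy.of_ringHom_of_comp_eq (RingHom.id H) (algebraMap F Ω) Function.surjective_id
      (algebraMap F Ω).injective (by ext c; rfl)
  haveI : Algebra.IsAlgebraic H L := Algebra.IsAlgebraic.trans H F L
  have hover : ∀ O : ValuationSubring L, O.comap (algebraMap F L) = V.comap (algebraMap F Ω) →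
      O.comap (algebraMap H L) = V.comap (algebraMap H Ω) := fun O hO => by
    rw [IsScalarTower.algebraMap_eq H F L, ← ValuationSubring.comap_comap, hO,
      ValuationSubring.comap_comap, ← IsScalarTower.algebraMap_eq]
  exact hH L inferInstance O₁ O₂ (hover O₁ h₁) (hover O₂ h₂)

variable {V} in
/-- **The fields of the class are henselian**: `K(x)^h` is henselian
(`Kuhlmann2010HenselizationIsHenselian_holds`, §1.1) and `F` is finite over it (Lemma 2.3).
PROVED. [cite: Kuhlmann2010, Section 2.5 and Lemma 2.3] -/
theorem IsHenselizedInertiallyGeneratedRT.isHenselianField [IsAlgClosed Ω] {K F : Subfield Ω}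
    (hF : IsHenselizedInertiallyGeneratedRT V K F) :
    IsHenselianField F (V.comap (algebraMap F Ω)) := by
  obtain ⟨x, -, -, hunr⟩ := hF
  exact IsHenselianField.of_subfield_algebraic V hunr.le
    (fun y hy => isAlgebraic_of_relfinrank_pos hunr.le hunr.relfinrank_pos hy)
    (Kuhlmann2010HenselizationIsHenselian_holds Ω V _)

/-! ### The fundamental inequality for subfields of `(Ω, V)` -/

/-- **The fundamental inequality `e·f ≤ n` inside `(Ω, V)`** (Kuhlmann 2010, §1, (1), for the one
extension `V ∩ B` of `V ∩ A`): for subfields `A ≤ B` with `[B : A]` finite, the relative index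
`(vB : vA)` and the relative degree `[Bv : Av]` are positive (finite) and
`(vB : vA)·[Bv : Av] ≤ [B : A]`. PROVED from `ramificationIndex_mul_inertiaDegree_le_finrank`
(`ValuationDefect.lean`) through the bridges of `DefectAmbient.lean`.
[cite: Kuhlmann2010, Section 1, (1)] -/
theorem relIndex_mul_relfinrank_le_relfinrank {A B : Subfield Ω} (h : A ≤ B)
    (hpos : 0 < Subfield.relfinrank A B) :
    0 < (valueSubgroup A V).relIndex (valueSubgroup B V) ∧
      0 < (residueSubfield A V).relfinrank (residueSubfield B V) ∧
      (valueSubgroup A V).relIndex (valueSubgroup B V) *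
          (residueSubfield A V).relfinrank (residueSubfield B V) ≤ Subfield.relfinrank A B := by
  set B' : IntermediateField A Ω := Subfield.extendScalars h with hB'
  have hfr : Subfield.relfinrank A B = Module.finrank A B' := Subfield.relfinrank_eq_finrank_of_le h
  haveI : FiniteDimensional A B' := by
    rw [hfr] at hpos
    exact Module.finite_of_finrank_pos hpos
  obtain ⟨hfi, hfin, hle⟩ :=
    ramificationIndex_mul_inertiaDegree_le_finrank A (V.comap (algebraMap B' Ω))
  have hrange : Set.range (algebraMap B' Ω) = Set.range (algebraMap B Ω) := by
    rw [range_algebraMap_intermediateField, range_algebraMap_subfield, hB', Subfield.coe_extendScalars]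
  have he : ramificationIndex A (V.comap (algebraMap B' Ω)) =
      (valueSubgroup A V).relIndex (valueSubgroup B V) := by
    rw [ramificationIndex_comap_eq_relIndex, valueSubgroup_eq_of_range_eq V hrange]
  have hf : inertiaDegree A (V.comap (algebraMap B' Ω)) =
      (residueSubfield A V).relfinrank (residueSubfield B V) := by
    rw [inertiaDegree_comap_eq_relfinrank, residueSubfield_eq_of_range_eq V hrange]
  refine ⟨?_, ?_, ?_⟩
  · rw [← he]
    exact Nat.pos_of_ne_zero hfi.index_ne_zero
  · rw [← hf]
    haveI := hfin
    exact Module.finrank_pos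
  · rw [← he, ← hf, hfr]
    exact hle

/-! ### Towers of steps of degree `p` are finite -/

variable {V}

/-- `[T : M] > 0` (indeed a power of `p`) along a tower of normal extensions of degree `p > 0`.
[folklore] -/
theorem IsNormalPTower.relfinrank_pos {p : ℕ} (hp : 0 < p) {M T : Subfield Ω}
    (h : IsNormalPTower p M T) : 0 < Subfield.relfinrank M T := by
  induction h with
  | refl M =>
    rw [Subfield.relfinrank_self]
    exact one_pos
  | step h₁ h₂ ih =>
    rw [← Subfield.relfinrank_mul_relfinrank h₁.le h₂.le, h₁.relfinrank_eq]
    exact Nat.mul_pos hp ih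

/-! ### Immediate extensions inside `Ω`: value groups and residue fields -/

variable (V)

/-- `(algebraMap E Ω).fieldRange = E` for a subfield `E`. [folklore] -/
theorem fieldRange_algebraMap_subfield (E : Subfield Ω) : (algebraMap E Ω).fieldRange = E := by
  ext y
  rw [RingHom.mem_fieldRange]
  constructor
  · rintro ⟨z, rfl⟩
    exact z.2
  · intro hy
    exact ⟨⟨y, hy⟩, rfl⟩

/-- The two renderings of the residue field of a subfield agree:
`residueSubfield E V = resField V E`. [folklore] -/
theorem residueSubfield_subfield_eq_resField (E : Subfield Ω) :
    residueSubfield E V = resField V E := by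
  rw [residueSubfield_eq_resField V, fieldRange_algebraMap_subfield]

/-- For an immediate `E|F` (`F ≤ E`) inside `(Ω, V)`: `vE = vF` and `Ev = Fv`. [folklore] -/
theorem IsImmediateOver.valueSubgroup_eq_and_residueSubfield_eq {F E : Subfield Ω} (hle : F ≤ E)
    (h : IsImmediateOver V F E) :
    valueSubgroup E V = valueSubgroup F V ∧ residueSubfield E V = residueSubfield F V := by
  obtain ⟨hv, hr⟩ := h
  constructor
  · refine le_antisymm (fun γ hγ => ?_) (valueSubgroup_subfield_mono hle)
    obtain ⟨c, hc0, hγc⟩ := (mem_valueSubgroup_iff E V γ).mp hγ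
    have hc0' : (c : Ω) ≠ 0 := fun h0 => hc0 (Subtype.ext h0)
    obtain ⟨b, hbF, hb⟩ := hv c c.2 hc0'
    refine (mem_valueSubgroup_iff F V γ).mpr ⟨⟨b, hbF⟩, ?_, ?_⟩
    · intro hb0
      have hb0' : b = 0 := congrArg Subtype.val hb0
      rw [hb0', map_zero, map_eq_zero] at hb
      exact hc0' hb
    · rw [hγc]
      exact hb
  · refine le_antisymm ?_ (residueSubfield_subfield_mono hle)
    rw [residueSubfield_subfield_eq_resField, residueSubfield_subfield_eq_resField]
    exact hr

/-! ### The displayed statement of p. 19 (named fact) and its proof from the ingredients -/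

/-- NAMED FACT — **Kuhlmann 2010, §5, p. 19 (displayed): no proper immediate algebraic
extensions.** "*Henselized inertially generated function fields of rank 1 and of transcendence
degree 1 with a valuation-transcendental generator over an algebraically closed ground field do
not admit proper immediate algebraic extensions.*" Vendored in the residue-transcendental case
(the class `IsHenselizedInertiallyGeneratedRT V K`, transcendence degree `1` being automatic),
inside the algebraically closed `(Ω, V)` with `char Ωv = p > 0` (the standing assumption of the
source), for algebraic extensions `E ≥ F` inside `Ω` that are immediate (§2.1: "the canonical
embeddings of `vK` in `vL` and of `Kv` in `Lv` are onto" — `IsImmediateOver V F E`): then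
`E = F`. PROVED below from its printed ingredients (`Kuhlmann2010NoImmediateExtensionRT.of_parts`);
kept as a named fact because it is the input of the proof of Lemma 5.5
(`Kuhlmann2010FiniteExtensionInertiallyGenerated`). [cite: Kuhlmann2010, Section 5, proof of (R4) (p. 19)] -/
def Kuhlmann2010NoImmediateExtensionRT : Prop :=
  ∀ (Ω : Type u) [Field Ω] [IsAlgClosed Ω] (V : ValuationSubring Ω) (p : ℕ) [CharP (ResidueField V) p],
    p.Prime → ∀ (K F E : Subfield Ω), IsAlgClosed K → IsHenselizedInertiallyGeneratedRT V K F →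
    F ≤ E → (∀ a ∈ E, IsAlgebraic F a) → IsImmediateOver V F E → E = F

variable {V}

/-- **The finite case**: for `F` in the class, `F ≤ E` finite with `vE = vF` and `Ev = Fv`,
`E = F` ("By Proposition 2.18 we have `d(E|F,v) = d(E.N|N,v)` … Since this is trivial if
`E.N = N`, we assume that `E.N ≠ N`. Then the first extension in the tower is defectless by
Corollary 4.2 or Proposition 3.1. This yields `d(E|F,v) = d(E.N|N,v) < [E.N:N] ≤ [E:F]`, that is,
`(E|F,v)` cannot be immediate"). PROVED from the three named facts: with `N` and the tower from
`Kuhlmann2010TameTowerReduction`, either `E.N = N`, and then `E ≤ N` is squeezed by the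
unramified `N|F` (`[N:F] = [Nv:Fv] = [Nv:Ev]·[Ev:Fv] ≤ [N:E]·1`, so `[E:F] = 1`), or the first
step `N₁|N` has `(vN₁:vN)[N₁v:Nv] = p` (`Kuhlmann2010NormalDegreePDefectless`), whence
`(v(E.N):vN)[(E.N)v:Nv] ≥ p ≥ 2`, while Prop. 2.18 (`Kuhlmann2010DefectUnramifiedBaseChange`)
with `(vE:vF)[Ev:Fv] = 1` gives `[E:F]·(v(E.N):vN)[(E.N)v:Nv] = [E.N:N] ≤ [E:F]`
(`relfinrank_sup_le_relfinrank`), a contradiction. [cite: Kuhlmann2010, Section 5, proof of (R4) (p. 19)] -/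
theorem eq_of_isHenselizedInertiallyGeneratedRT_of_immediate_finite [IsAlgClosed Ω] {p : ℕ}
    [CharP (ResidueField V) p] (hp : p.Prime) (hα : Kuhlmann2010TameTowerReduction.{u})
    (hγ : Kuhlmann2010DefectUnramifiedBaseChange.{u}) (hδ : Kuhlmann2010NormalDegreePDefectless.{u})
    {K F E : Subfield Ω} (hK : IsAlgClosed K) (hF : IsHenselizedInertiallyGeneratedRT V K F)
    (hle : F ≤ E) (hpos : 0 < Subfield.relfinrank F E)
    (hv : valueSubgroup E V = valueSubgroup F V) (hr : residueSubfield E V = residueSubfield F V) :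
    E = F := by
  have hFh : IsHenselianField F (V.comap (algebraMap F Ω)) := hF.isHenselianField
  obtain ⟨N, hN, htower⟩ := hα Ω V p hp K F E hK hF hle hpos
  -- Lemma 2.27: `N` is in the class
  have hNC : IsHenselizedInertiallyGeneratedRT V K N := hF.of_isUnramifiedOver hN
  obtain ⟨hFN, hNpos, hNdeg, -, -⟩ := id hN
  -- `(vE : vF)[Ev : Fv] = 1`
  have hefE : (valueSubgroup F V).relIndex (valueSubgroup E V) *
      (residueSubfield F V).relfinrank (residueSubfield E V) = 1 := by
    rw [hv, hr, Subgroup.relIndex_self, Subfield.relfinrank_self]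
  -- Prop. 2.18: `[E : F] · (v(E.N) : vN)[(E.N)v : Nv] = [E.N : N]`
  have h218 := hγ Ω V F N E hFh hN hle hpos
  rw [hefE, mul_one] at h218
  -- `[E.N : N] ≤ [E : F]`
  have hbase : Subfield.relfinrank N (E ⊔ N) ≤ Subfield.relfinrank F E := by
    rw [sup_comm]
    exact relfinrank_sup_le_relfinrank hFN hle hpos.ne'
  -- the tower, with its top generalized
  obtain ⟨T, hT, htower'⟩ : ∃ T : Subfield Ω, E ⊔ N = T ∧ IsNormalPTower p N T := ⟨_, rfl, htower⟩
  rw [hT] at h218 hbase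
  rcases htower' with _ | @⟨_, N₁, _, h₁, h₂⟩
  · -- `E.N = N`: `F ≤ E ≤ N` with `N|F` unramified and `Ev = Fv` forces `[E : F] = 1`
    have hEN : E ≤ N := sup_eq_right.mp hT
    have hmul := Subfield.relfinrank_mul_relfinrank hle hEN
    have hn₂ : 0 < Subfield.relfinrank E N := by
      rcases Nat.eq_zero_or_pos (Subfield.relfinrank E N) with h0 | h0
      · rw [h0, mul_zero] at hmul
        omega
      · exact h0
    obtain ⟨he, -, hfi⟩ := relIndex_mul_relfinrank_le_relfinrank V hEN hn₂
    have hres : (residueSubfield F V).relfinrank (residueSubfield N V) =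
        (residueSubfield E V).relfinrank (residueSubfield N V) := by
      rw [← Subfield.relfinrank_mul_relfinrank (residueSubfield_subfield_mono (V := V) hle)
        (residueSubfield_subfield_mono hEN), hr, Subfield.relfinrank_self, one_mul]
    have hle' : Subfield.relfinrank F N ≤ Subfield.relfinrank E N := by
      rw [hNdeg, hres]
      exact (Nat.le_mul_of_pos_left _ he).trans hfi
    have h1 : Subfield.relfinrank F E = 1 := by
      have h3 : Subfield.relfinrank F E * Subfield.relfinrank E N ≤ 1 * Subfield.relfinrank E N := by
        rw [hmul, one_mul]
        exact hle'
      have h4 := Nat.le_of_mul_le_mul_right h3 hn₂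
      omega
    exact le_antisymm (Subfield.relfinrank_eq_one_iff.mp h1) hle
  · -- a first step `N ≤ N₁`, normal of degree `p`, defectless (Cor. 4.2 / Prop. 3.1)
    obtain ⟨hNN₁, -, heq₁⟩ := hδ Ω V p hp K N N₁ hK hNC h₁
    have hp₁ : (valueSubgroup N V).relIndex (valueSubgroup N₁ V) *
        (residueSubfield N V).relfinrank (residueSubfield N₁ V) = p := by
      rw [← heq₁, h₁.relfinrank_eq]
    have hN₁T : N₁ ≤ T := h₂.le
    obtain ⟨he₂, hf₂, -⟩ := relIndex_mul_relfinrank_le_relfinrank V hN₁T (h₂.relfinrank_pos hp.pos)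
    -- `(vT : vN)[Tv : Nv] ≥ p`
    have hef : p ≤ (valueSubgroup N V).relIndex (valueSubgroup T V) *
        (residueSubfield N V).relfinrank (residueSubfield T V) := by
      rw [← Subgroup.relIndex_mul_relIndex _ _ _ (valueSubgroup_subfield_mono hNN₁)
          (valueSubgroup_subfield_mono hN₁T),
        ← Subfield.relfinrank_mul_relfinrank (residueSubfield_subfield_mono (V := V) hNN₁)
          (residueSubfield_subfield_mono hN₁T)]
      calc p = (valueSubgroup N V).relIndex (valueSubgroup N₁ V) *
            (residueSubfield N V).relfinrank (residueSubfield N₁ V) * 1 := by rw [hp₁, mul_one]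
        _ ≤ (valueSubgroup N V).relIndex (valueSubgroup N₁ V) *
            (residueSubfield N V).relfinrank (residueSubfield N₁ V) *
            ((valueSubgroup N₁ V).relIndex (valueSubgroup T V) *
              (residueSubfield N₁ V).relfinrank (residueSubfield T V)) :=
          Nat.mul_le_mul_left _ (Nat.mul_pos he₂ hf₂)
        _ = _ := by ring
    -- `[E:F]·2 ≤ [E:F]·(vT:vN)[Tv:Nv] = [T:N] ≤ [E:F]`, absurd
    exfalso
    have h3 : Subfield.relfinrank F E * 2 ≤ Subfield.relfinrank F E * 1 :=
      calc Subfield.relfinrank F E * 2 ≤ Subfield.relfinrank F E * p :=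
            Nat.mul_le_mul_left _ hp.two_le
        _ ≤ Subfield.relfinrank F E * ((valueSubgroup N V).relIndex (valueSubgroup T V) *
            (residueSubfield N V).relfinrank (residueSubfield T V)) := Nat.mul_le_mul_left _ hef
        _ = Subfield.relfinrank N T := h218
        _ ≤ Subfield.relfinrank F E := hbase
        _ = Subfield.relfinrank F E * 1 := (mul_one _).symm
    have h4 := Nat.le_of_mul_le_mul_left h3 hpos
    omega

/-- **Kuhlmann 2010, §5, p. 19 (displayed statement), residue-transcendental case: PROVED from
the reduction of pp. 18–19 (with Lemma 2.27), Prop. 2.18 and Cor. 4.2 / Prop. 3.1**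
(`Kuhlmann2010TameTowerReduction`, `Kuhlmann2010DefectUnramifiedBaseChange`,
`Kuhlmann2010NormalDegreePDefectless`). An immediate algebraic extension `E ≥ F` inside `Ω` is
the union of its finite subextensions `F(a)`, which are immediate, hence trivial by the finite
case (`eq_of_isHenselizedInertiallyGeneratedRT_of_immediate_finite`).
[cite: Kuhlmann2010, Section 5, proof of (R4) (pp. 18–19)] -/
theorem Kuhlmann2010NoImmediateExtensionRT.of_parts (hα : Kuhlmann2010TameTowerReduction.{u})
    (hγ : Kuhlmann2010DefectUnramifiedBaseChange.{u})
    (hδ : Kuhlmann2010NormalDegreePDefectless.{u}) : Kuhlmann2010NoImmediateExtensionRT.{u} := by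
  intro Ω _ _ V p _ hp K F E hK hF hle halg himm
  refine le_antisymm (fun a ha => ?_) hle
  -- the finite immediate subextension `E₀ = F(a)`
  let E₀' : IntermediateField F Ω := IntermediateField.adjoin F ({a} : Set Ω)
  have hFE₀ : F ≤ E₀'.toSubfield := subfield_le_toSubfield E₀'
  have haE₀ : a ∈ E₀'.toSubfield := IntermediateField.subset_adjoin F ({a} : Set Ω) rfl
  have hE₀E : E₀'.toSubfield ≤ E := by
    have h1 : E₀' ≤ Subfield.extendScalars hle :=
      IntermediateField.adjoin_le_iff.mpr (Set.singleton_subset_iff.mpr ha)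
    exact fun y hy => h1 hy
  haveI : FiniteDimensional F E₀' :=
    IntermediateField.adjoin.finiteDimensional (halg a ha).isIntegral
  have hpos : 0 < Subfield.relfinrank F E₀'.toSubfield := by
    rw [relfinrank_toSubfield_eq_finrank]
    exact Module.finrank_pos
  obtain ⟨hvE, hrE⟩ := himm.valueSubgroup_eq_and_residueSubfield_eq V hle
  have hv₀ : valueSubgroup E₀'.toSubfield V = valueSubgroup F V :=
    le_antisymm (hvE ▸ valueSubgroup_subfield_mono hE₀E) (valueSubgroup_subfield_mono hFE₀)
  have hr₀ : residueSubfield E₀'.toSubfield V = residueSubfield F V :=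
    le_antisymm (hrE ▸ residueSubfield_subfield_mono hE₀E) (residueSubfield_subfield_mono hFE₀)
  have hE₀F := eq_of_isHenselizedInertiallyGeneratedRT_of_immediate_finite hp hα hγ hδ hK hF hFE₀
    hpos hv₀ hr₀
  rw [← hE₀F]
  exact haE₀

/-! ### The trust base of (R4), `t` residue-transcendental, with Thm. 2.14 discharged -/

/-- **`Kuhlmann2010StabilityRankOneResidueTranscendental` from the five named facts of
`HenselizedFunctionFields.lean` alone**: Thm. 2.14 (`Kuhlmann2010DefectlessIffHenselization_holds`,
`HenselizationDefectless.lean`) and §1.1 (`Kuhlmann2010HenselizationIsHenselian_holds`) being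
PROVED, (R4) for `K(t)` with a residue-transcendental generator rests on Cor. 2.12, the reduction
of pp. 18–19 (with Lemma 2.27), Prop. 2.18, Cor. 4.2 / Prop. 3.1 and Lemma 5.5. PROVED.
[cite: Kuhlmann2010, Section 5, Lemma 5.4 (R4) and proof of (R4) (pp. 18–20)] -/
theorem Kuhlmann2010StabilityRankOneResidueTranscendental.of_namedFacts
    (h212 : Kuhlmann2010DefectlessOfResidueCharZero.{u})
    (hα : Kuhlmann2010TameTowerReduction.{u})
    (hγ : Kuhlmann2010DefectUnramifiedBaseChange.{u})
    (hδ : Kuhlmann2010NormalDegreePDefectless.{u})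
    (hζ : Kuhlmann2010FiniteExtensionInertiallyGenerated.{u}) :
    Kuhlmann2010StabilityRankOneResidueTranscendental.{u} :=
  Kuhlmann2010StabilityRankOneResidueTranscendental.of_ingredients
    Kuhlmann2010DefectlessIffHenselization_holds h212 hα hγ hδ hζ

end Literature.AlgebraicGeometry.Resolution
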